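import Mathlib.FieldTheory.IsAlgClosed.AlgebraicClosure
import Literature.AnabelianGeometry.SemiGraphs.TemperedCurves
import HarnessLib

/-!
# A degenerate inhabitant of the tempered-`π₁` interface `TemperedArithmeticGroup`

Vacuity-lane companion (abc-iut cell) of `TemperedCurves.lean` (abc-iut-L3-t2): Mochizuki,
*Semi-graphs of anabelioids*, Publ. RIMS **42** (2006), Example 3.10, manuscript pp. 43–45
[cite: MochizukiSemiAnbd2006, Ex 3.10 pp.43-45] is typed there as an INTERFACE — a structure of data
and `Prop`-fields quoting print — for the tempered fundamental group of a smooth log curve over a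
finite extension of `ℚ_p`, which the tree does not construct.  This file kernel-checks that the
axiom set of that interface is JOINTLY SATISFIABLE, by the degenerate inhabitant over an
algebraically closed field `K`: then `G_K = Gal(K̄/K)` is trivial, and `Π := G_K` with the identity
augmentation satisfies every field (a trivial group is tempered, slim and Galois-countable).

HONEST LIMITS.  This is consistency evidence only: it says nothing about `K/ℚ_p` finite (the
intended case, which needs André's `π₁^temp`), and nothing about `OncePuncturedTemperedGroup`
(whose inhabitant needs a provably SLIM non-compact tempered group surjecting onto `ℤ` — free /
profinite-free centraliser theory absent from Mathlib).  No census node; no statement of the paper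
is asserted.  Nothing here takes a side on [IUTchIII] Cor. 3.12.
-/

noncomputable section

namespace Literature.AnabelianGeometry.SemiGraphs

open Literature.AlgebraicGeometry.Frobenioids (IsSlimGroup)
open Topology

universe u

/-- Over an algebraically closed field the absolute Galois group `Gal(K̄/K)` is trivial: every
`K`-automorphism of `K̄` is the identity, since `K → K̄` is surjective
(`IsAlgClosed.algebraMap_bijective_of_isIntegral`). [folklore] -/
private theorem subsingleton_absoluteGaloisGroup (K : Type u) [Field K] [IsAlgClosed K] :
    Subsingleton (Field.absoluteGaloisGroup K) := by
  refine ⟨fun σ τ => ?_⟩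
  refine AlgEquiv.ext fun x => ?_
  obtain ⟨k, rfl⟩ :=
    (IsAlgClosed.algebraMap_bijective_of_isIntegral (k := K) (K := AlgebraicClosure K)).2 x
  rw [AlgEquiv.commutes, AlgEquiv.commutes]

/-- A topological group with one element is tempered (Def. 3.1 (i): all three clauses are trivial).
[folklore] -/
private theorem isTempered_of_subsingleton (G : Type u) [Group G] [TopologicalSpace G]
    [Subsingleton G] : IsTempered G where
  basis U hU :=
    ⟨{ toOpenSubgroup := ⊤
       isNormal' := by change (⊤ : Subgroup G).Normal; infer_instance },
      inferInstance, fun g _ => by rw [Subsingleton.elim g 1]; exact mem_of_mem_nhds hU⟩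
  separated g hg := absurd (Subsingleton.elim g 1) hg
  complete x _ := ⟨1, fun N => by
    obtain ⟨g, hg⟩ := QuotientGroup.mk_surjective (x N)
    rw [← hg, Subsingleton.elim g 1]⟩

/-- A topological group with one element is slim (every subgroup is `⊥`). [folklore] -/
private theorem isSlimGroup_of_subsingleton (G : Type u) [Group G] [TopologicalSpace G]
    [Subsingleton G] : IsSlimGroup G :=
  ⟨fun _ _ => Subsingleton.elim _ _⟩

/-- **Consistency witness for the interface `TemperedArithmeticGroup`** ([SemiAnbd] Ex. 3.10 as typed
in `TemperedCurves.lean`): for `K` algebraically closed, `Π := Gal(K̄/K)` (trivial) with the identity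
augmentation inhabits the structure — every `Prop`-field of the interface holds for it.  Degenerate:
see the module docstring for what this does NOT show. [cite: MochizukiSemiAnbd2006, Ex 3.10 pp.43-45] -/
theorem TemperedArithmeticGroup.nonempty_of_isAlgClosed (K : Type u) [Field K] [IsAlgClosed K] :
    Nonempty (TemperedArithmeticGroup K) := by
  haveI := subsingleton_absoluteGaloisGroup K
  haveI : Subsingleton (ContinuousMonoidHom.id (Field.absoluteGaloisGroup K)).toMonoidHom.ker :=
    inferInstance
  exact
    ⟨{ Pi := Field.absoluteGaloisGroup K
       isTempered := isTempered_of_subsingleton _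
       aug := ContinuousMonoidHom.id _
       aug_surjective := fun g => ⟨g, rfl⟩
       isTempered_ker := isTempered_of_subsingleton _
       isSlimGroup := isSlimGroup_of_subsingleton _
       isSlimGroup_ker := isSlimGroup_of_subsingleton _
       secondCountableTopology := inferInstance }⟩

end Literature.AnabelianGeometry.SemiGraphs

end
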